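import Summits.HodgeConjecture.HodgeConjecture.Theses.DworkReflectionQuotients
import Literature.AlgebraicGeometry.HodgeTheory.DworkSexticReflectionQuotient
import Summits.HodgeConjecture.HodgeConjecture.Theorems.BoundaryReadoutPullbackAlgebraic

/-!
# Crux K1 `ReflectionQuotientDescent` of route `DworkReflectionQuotients`, modulo its two named facts
# (Bredon's transfer; Bini–Garbagnati's smooth rationally connected reflection quotient)

Route `route-HodgeConjecture-DworkReflectionQuotients` (cell `hodge-nonav`, rung F-H1 — never summit
credit), item `stmt-HodgeConjecture-20240`; landed `--supports stmt-HodgeConjecture-20240`. A CONDITIONAL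
result (credits nothing): its hypotheses are the tree's named facts
`bredon1997_quotient_cohomology_invariants` (transfer `H⁴(X/⟨s⟩; ℚ) ≅ H⁴(X; ℚ)^s`, Bredon 1972 / 1997
II.19.2) and `DworkSextic.BiniGarbagnati2012_reflectionQuotient_smoothProjective_rcc` (Bini–Garbagnati
2012 Prop. 3.20 with Campana / Kollár–Miyaoka–Mori: the reflection quotient of `X_ψ` is a smooth
projective rationally chain connected fourfold); the third input of the Literature lemma, Fulton's
pull-back shape `fulton1998_map_mem_algebraicClasses`, is the tree theorem
`fulton1998_map_mem_algebraicClasses_holds` (`Theorems/BoundaryReadoutPullbackAlgebraic`). This is the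
planner's turnkey (evidence `K1Proof.lean`, p2 g9: one application of
`DworkSextic.mem_algebraicClasses_of_isRefl_invariant`, Literature p470242), landed by the prover seat
`hodge-nonav-20241-p1` (g0), 2026-08-27. The item stays open until the two facts are discharged.

## References

* G. E. Bredon, *Sheaf Theory*, 2nd ed., GTM 170 (1997), II.19.2. [Bredon1997]
* G. Bini, A. Garbagnati, *Quotients of the Dwork pencil*, J. Geom. Phys. 75 (2014), Prop. 3.20.
  [BiniGarbagnati2012]
* S. Bloch, V. Srinivas, *Remarks on correspondences and algebraic cycles*, Amer. J. Math. 105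
  (1983), Thm. 1 (3). [BlochSrinivas1983]
* W. Fulton, *Intersection Theory* (1998), §19.2. [Fulton1998]
-/

namespace Summit.HodgeConjecture.HodgeConjecture.Theorems

open Literature.AlgebraicGeometry.HodgeTheory Literature.AlgebraicTopology.SingularHomology

/-- **Crux K1 modulo Bredon + Bini–Garbagnati.** Granted the named facts
`bredon1997_quotient_cohomology_invariants` and
`DworkSextic.BiniGarbagnati2012_reflectionQuotient_smoothProjective_rcc`, the route statement
`ReflectionQuotientDescent` holds: for `ψ⁶ ≠ 1`, `i ≠ j`, `ζ⁶ = 1` and any continuous self-map `g` of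
`X_ψ(ℂ)` realising `s_(i,j,ζ)`, every rational `(2,2)`-class fixed by `g^*` is algebraic (it descends
to the smooth rationally connected quotient, where Bloch–Srinivas / the tree's
`hodgeConjectureFor_four_of_hasChowZeroSupportedInDimLE` applies, and pulls back algebraically by
`fulton1998_map_mem_algebraicClasses_holds`). One application of
`DworkSextic.mem_algebraicClasses_of_isRefl_invariant`. CONDITIONAL on the two facts.
[cite: BiniGarbagnati2012, Prop. 3.20] [cite: BlochSrinivas1983, Thm. 1 (3)] -/
theorem reflectionQuotientDescent_of_facts
    (hB : bredon1997_quotient_cohomology_invariants)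
    (h : DworkSextic.BiniGarbagnati2012_reflectionQuotient_smoothProjective_rcc) :
    Summit.HodgeConjecture.HodgeConjecture.Theses.DworkReflectionQuotients.ReflectionQuotientDescent := by
  intro ψ hψ
  dsimp only
  intro i j hij ζ hζ g hg c hcr hct hc
  exact DworkSextic.mem_algebraicClasses_of_isRefl_invariant hψ hij hζ hB h
    fulton1998_map_mem_algebraicClasses_holds hg hcr hct hc

end Summit.HodgeConjecture.HodgeConjecture.Theorems
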